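import Literature.MathematicalPhysics.QuantumFieldTheory.Balaban1983to89.B8Thm2TorusUniqPer
import Literature.MathematicalPhysics.QuantumFieldTheory.Balaban1983to89.B8Prop5SocketDatumSrcGammaPrime

/-!
# `Balaban1983to89.B8SockP5uEBodyNestedPer` — [Balaban1985RegularSpaces] Prop. 5 (1.109) p. 94 («such a configuration u′ is unique») for Theorem 4's
# datum (p. 95) at a NESTED member `Ω₀ = T_η ⊃ Ω₁ ⊃ … ⊃ Ω_k` ON THE TORUS (§3 p. 98: `P`-periodic objects read on `ηℤᵈ`), EDITION γ′ (print's p. 77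
# one-end-point class for (1.35); the b9 input = the two SOURCED (1.59)-lines at the datum): the provider BODY of the N05 knit's uniqueness socket `SP5u`
# — brick U1 of the interface request B8-P5-NESTED-SERVER (uniqueness half)

statement-level skeleton of published theorems with citation tags; proofs where landed; nothing here is a claim about the Yang–Mills mass gap

T. Bałaban, *Spaces of regular gauge field configurations on a lattice and gauge fixing conditions*, Commun. Math. Phys. **99** (1985) 75–102
`[Balaban1985RegularSpaces]` ("B8"; printed page = PDF page + 74): Prop. 5 (1.107)–(1.109) p. 94, Thm 4 p. 88 and p. 95 (the uniqueness paragraph: «thus u′ is a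
solution of the problem described in Proposition 5 … The uniqueness implies u′ = 1»), (1.67)–(1.69) p. 88, (1.112) p. 95, (1.29) p. 81, (1.31) + (1.35) p. 82, p. 77
(«Ω also denotes the set of bonds … at least one end-point of b belongs to Ω»; «Ω₀ ⊃ Ω₁ ⊃ … we admit the case when some domains Ω_j are equal to T_η»), (1.5)–(1.6)
p. 77, Prop. 3 p. 87, (1.59)–(1.62) pp. 86–87, §3 p. 98.  T. Bałaban, *Propagators for lattice gauge theories in a background field*, CMP **99** (1985) 389–434
`[Balaban1985BackgroundPropagators]` ("[4]"): Thm 3.1 p. 397, (3.24)–(3.25) p. 394, Thm 3.3 p. 398.  `[Balaban1985Averaging]` ("[3]"): Prop. 4 p. 38, (4) p. 18 (the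
torus `T_η` as `P`-periodic data on `ηℤᵈ`).  PDF held: `paper:balaban1985-cmp99-regular-spaces-gauge-fixing`.  STATUS: published, refereed.

CITATION HEADER (lean-in-tree rule).  Cell `lit-balaban`, seat `lit-balaban-p21` (gen 39), sub-row «G-B8-T2S» (R3 `stmt-QuantumFields-19200`, `--supports`, helper; the
consumers bear on `stmt-QuantumFields-27364`).  Interface request B8-P5-NESTED-SERVER (pub-ymgap dag-n05-c g17, 2026-08-28; lit-balaban lead g33 commission
`lit-balaban-p21/WAKE-B8P5NestedServerUniq.md`): serve the uniqueness socket `SP5u` :174–:194 of `B8Thm4CoreZdGF3HP2PerLanEGamma` (T5) at NESTED PERIODIC members.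

WHAT THIS FILE PROVES (one theorem, no `def`).
★ `sockP5uE_body_γ'_per` — the all-torus template's nested-generic body `B8Thm2TorusUniqPer.sockP5uE_body_of_join_b_per` (RULING #4: the [4] letters' (U1) `g_leftB`
read at PERIODIC bounded functions, (U2) `c_left'` at LEVEL-PERIODIC multipliers, (1.91) `hQH` at LEVEL-PERIODIC families; `G′` periodic-valued, `𝔄` level-periodic-valued,
`H′` periodicity-preserving; `Lʲ ∣ P`, shift-invariant `Λ_j`; periodic `U₀`, `U′`, `u₁`; engine `B8Prop5UniqSectEWPer.hFP_unique_of_sectE_local_wb_per` BY NAME; the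
competitor's Landau multiplier replaced by its LEVEL-PERIODIC representative `B8Thm2TorusServerPer.exists_levelPeriodic_multiplier` BY NAME — that lemma is keyed on a
general family `Λs : ℕ → Set` and any periodic left side, so no nested analogue had to be declared) VERBATIM EXCEPT, following dag-n05-w4's `ℤᵈ` γ′ body
`B8SockP5uEAssemblyBSrcGammaPrime.sockP5uE_body_of_join_b_src_γ'` token for token: (i) the datum's gauge condition is an ABSTRACT `Lan k (U′^{u₁⁻¹})` (the (1.42)
lemma reads it abstractly); (ii) the b9 input is the SOURCED one at the datum — `SH59k`: the two (1.59)-lines with source terms `Sa`, `Sg` for every PERIODIC masked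
exponent of `U′^{u₁⁻¹}` (what the knit's periodicity-guarded `SH59src` delivers at `(k, u₁, U′^{u₁⁻¹})`), whence the gradient member of (1.69) by
`B8Prop5SocketDatumSrcGammaPrime.grad_bound_of_datum_src_γ'` ((1.35) in print's p. 77 ONE-END-POINT class, class law «box ⊂ Ω_{j−1}» for `Λb`, tower law at
truncation `k`, [3] Prop. 4's windows one level lower at `(L²α₀, c_B)`, the (1.56) constant `C₂` `L²`-scaled) and `|D*A′|₍₋₂₎ ≤ d·L²·(c⋆ + 2Sg) ≤ c_{DA}`;
(iii) the competitors' exponents `λ`, `μ` are periodic AS GIVEN (T5's socket hands `IsPeriodic (p a) lam ∕ mu`); (iv) periodicity of the data `U₀`, `U′`, `u₁`,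
`λ`, `μ` is taken on the FULL period lattice `x + P • m` (T5's `T4TermwiseTorus.IsPeriodic` currency, `P : ℤ`), the engines' one-direction form `z + P • e i`
being read off inside.  Zero source (instance (i) of the request: the competitors' conditions are `IsLandau138W`).  CONCLUSION unchanged: `∀ x, v x = w x`.

HONEST SCOPE.  Composition of landed theorems; Proposition 5 ∕ [4] ∕ Sect. E are NOT re-proved; the [4] letters with their laws at periodic arguments, the sourced
b9 lines at the datum and the windows are DISPLAYED hypotheses (explicit and merely sufficient); the level-periodic-multiplier premise of the per engine is
DISCHARGED here; `d ≥ 2`, `L ≥ 2`, `Ω 0 = univ`, `𝔸` a C⋆-algebra.  Count-neutral; N05 ∕ `stub_PV3A` NOT discharged; one finite `T⁴` programme at fixed `ε` —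
nothing continuum ∕ ℝ⁴ ∕ OS ∕ mass-gap ∕ Clay: the Yang–Mills mass gap is NOT proved.  No `sorry`, no `def`, no `… : Prop` fact, no `instance`, no `notation`.

RELATED IN THE TREE, NOT DUPLICATED: `B8Thm2TorusUniqPer` (t2s-1 g3; all-torus storey, template), `B8SockP5uEAssemblyBSrcGammaPrime` (dag-n05-w4; `ℤᵈ` γ′ body),
`B8Prop5SocketDatumSrcGammaPrime` (dag-n05-w4; USED), `B8Prop5UniqSectEWPer` ∕ `B8Thm2TorusServerPer` (t2s-1; USED).
-/

noncomputable section

open NormedSpace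
open scoped BigOperators

namespace Literature.MathematicalPhysics.QuantumFieldTheory.Balaban1983to89.B8SockP5uEBodyNestedPer

open Complex (I)
open MatrixLog (mlog)
open B7Prop1Explicit B7Prop2Explicit B7Prop1Local B7Eq92Concrete
open B7Prop2Explicit (C0 c2')
open B7Prop3Flat (c3)
open B7Prop10General (C6 C4G)
open B7Prop9Flat (C5')
open B7Eq78Linearization (conjR zdBlocking QprimeIter)
open B7Eq167Flat (InLambda)
open B8Ineq132 (covDerivFwd covDeriv InAk norm_conjR)
open B8Eq119TwistedAxial (Restr129 InAx bgT)
open B8Eq184Proof (gaugeExp cfgExp)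
open B8Eq182Proof (gAd)
open B8Eq188Proof (frakF3)
open B8Lemma1NonAbelian (mulCfg)
open B8Eq140Level (SideTouches)
open B8Eq146AExpansion (iEta expCfg)
open B8Ineq130 (tlo thi)
open B8Thm2LogB (blockTop)
open B8Eq138LandauZd (IsLandau138 IsLandau138W covDivB covLap QT logCfg)
open B8Ineq125Concrete (C2p)
open B8Eq1117Concrete (XSpace)
open B8Eq1117KLevel (glev_on_towers_of_axial)
open B8SectEInLambdaWitness (witness_unitary_of_glev)
open B8Prop3GaugeFixedKLevel (expCfg_iEta_eq_cfgExp logField_spec mem_unitaryUnits_of_mgauge_eq)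
open B8Eq155JBound (Jcur wsup expCfg_iEta_mem_unitaryUnits)
open B7Prop4GeneralLevels (linCovIter)
open B8ScaledSupNorm (bondNorm msup)
open B8Thm4AtLandau138 (mgauge_mgauge_inv)
open B8Thm4Concrete (mulCfg_eq_mul)
open B8Prop5ContractionKLevel (Bd2 Mc Kc)
open B8LambdaSpaceKLevel (wt wt_nonneg)
open B8Prop5GaugeParamKLevel (norm_covDeriv_eq)
open B8Prop5KLevelLetters (covDivB_logCfg_gaugeFixed)
open B8Prop5SocketDatum (exists_masked_datum bd2_covDivB_of_grad sideTouches_pair_of_mem sideTouches_of_tower_bond h33_of_inAk hP_of_datum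
  h69_of_datum hA_of_datum)
open B8Prop5SocketDatumSrcGammaPrime (grad_bound_of_datum_src_γ')
open B8Prop5UniqSectEWPer (hFP_unique_of_sectE_local_wb_per)
open B8Prop5NeumannPeriodic (covDivB_per)
open B8Thm2TorusSupplier (mgauge_periodic)
open B8Thm2TorusLettersPerConv (covLap_per)
open B8Thm2TorusServerPer (exists_levelPeriodic_multiplier gaugeExp_per)

-- `Site` alone could resolve to the torus sites of `Setup.lean`; re-export the `ℤ^d` sites of `B7Prop1Explicit`.
export B7Prop1Explicit (Site)

variable {d : ℕ} {𝔸 : Type*} [CStarAlgebra 𝔸] [Nontrivial 𝔸]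

/-! ## §1 The provider body of the uniqueness socket at one nested periodic member, zero source, edition γ′ -/

/-- ★ **PROPOSITION 5's UNIQUENESS CLAUSE (1.109) FOR THEOREM 4's DATUM AT A NESTED MEMBER ON THE TORUS, THE [4] LETTERS' LAWS AT PERIODIC ARGUMENTS, EDITION γ′**
(Prop. 5 (1.109) p. 94 used as on p. 95; §3 p. 98; the body of the N05 knit's uniqueness socket `SP5u` at one member with `Ω₀ = T_η`, instance «zero source»).
`B8Thm2TorusUniqPer.sockP5uE_body_of_join_b_per` VERBATIM except: (i) the datum's gauge condition is an ABSTRACT `Lan k (U′^{u₁⁻¹})`; (ii) the b9 input is the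
SOURCED one at the datum (`SH59k`: the two (1.59)-lines with source terms `Sa`, `Sg` for every PERIODIC masked exponent of `U′^{u₁⁻¹}` — what the knit's guarded
`SH59src` delivers), whence `|D*A′|₍₋₂₎ ≤ d·L²·(c⋆ + 2Sg) ≤ c_{DA}` by `grad_bound_of_datum_src_γ'` ((1.35) in print's p. 77 one-end-point class, class law
«box ⊂ Ω_{j−1}», [3] Prop. 4's windows at `(L²α₀, c_B)`, `C₂` `L²`-scaled); (iii) the competitors' exponents are periodic as given; (iv) periodicity of
`U₀, U′, u₁, λ, μ` on the full period lattice `x + P • m`.  The member carries `Lʲ ∣ P` (`j ≤ k`) and shift-invariant `Λ_j`; (U1) `g_leftB` at PERIODIC bounded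
functions, (U2) `c_left'` at LEVEL-PERIODIC multipliers, (1.91) `hQH` at LEVEL-PERIODIC families; `G′` periodic-valued, `𝔄` level-periodic-valued, `H′`
periodicity-preserving.  CLAIM: two competitors `v = e^{iλ}`, `w = e^{iμ}` in print's domain «|λ|, |Dλ|₍₋₁₎ < c_u», both putting `U′^{u₁⁻¹}` in the (1.38)-gauge
at level `k` with (1.29), coincide.  PROOF: the periodic datum dictionary of the template (`B8Prop5SocketDatum`; the masked exponent `A′ = (iη)⁻¹ log U₁` is periodic
with `U₁ = U′^{u₁⁻¹}`), the gradient member of (1.69) by `grad_bound_of_datum_src_γ'` on `SH59k` at `A′`, each competitor's Landau multiplier replaced by its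
level-periodic representative (`B8Thm2TorusServerPer.exists_levelPeriodic_multiplier`), then `B8Prop5UniqSectEWPer.hFP_unique_of_sectE_local_wb_per`.
[cite: Balaban1985RegularSpaces, Prop. 5 (1.109) p.94, Thm 4 p.88, p.95 (uniqueness paragraph), (1.67)–(1.69) p.88, (1.112) p.95, (1.29) p.81, (1.35) p.82, p.77, Prop. 3 p.87, (1.59)–(1.62) pp.86–87, §3 p.98; Balaban1985Averaging, Prop. 4 p.38, (166)–(167) p.44; Balaban1985BackgroundPropagators, Thm 3.1 p.397, (3.24)–(3.25) p.394, Thm 3.3 p.398] -/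
theorem sockP5uE_body_γ'_per (hd2 : 2 ≤ d) {L : ℕ} (hL : 2 ≤ L) {η : ℝ} (hη : 0 < η) {k : ℕ} (hk : 1 ≤ k) (P : ℤ)
    -- the member's geometry (`Ω 0 = univ` sub-family)
    {Ω : ℕ → Set (Site d)} (hΩ : ∀ j, Ω (j + 1) ⊆ Ω j) (hΩ0 : Ω 0 = Set.univ) {Λs : ℕ → ℕ → Set (Site d)} {Λb : ℕ → ℕ → Set (Site d × Fin d)}
    -- PRINT's box law for the class read by the sourced b9 lines: the locality box of a level-`j` class bond lies in `Ω_{j−1}` ((1.31); level 0: `Ω₀`)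
    (hbox : ∀ m, m ≤ k → ∀ j, j ≤ m → ∀ c ∈ Λb m j, ∀ x, InBox (loK L j c.1) (bondHiK L j c.1 c.2) x → x ∈ Ω (j - 1))
    (hclass : ∀ m, m ≤ k → ∀ j, j ≤ m → ∀ c ∈ Λb m j,
      (c.1 ∈ Λs m j ∧ c.1 + e c.2 ∈ Λs m j) ∨
      (∃ j', j = j' + 1 ∧ (∀ x, (L : ℤ) • c.1 ≤ x → x ≤ (L : ℤ) • c.1 + blockTop L → x ∈ Λs m j') ∧ c.1 + e c.2 ∈ Λs m j) ∨
      (∃ j', j = j' + 1 ∧ c.1 ∈ Λs m j ∧ (∀ x, (L : ℤ) • (c.1 + e c.2) ≤ x → x ≤ (L : ℤ) • (c.1 + e c.2) + blockTop L → x ∈ Λs m j')))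
    (htower : ∀ j, j ≤ k → ∀ y ∈ Λs k j, ∀ x, InBox (tlo L y j) (thi L y j) x → x ∈ Ω j)
    -- the torus: `Lʲ ∣ P`, shift-invariant `Λ_j`
    (hdiv : ∀ j, j ≤ k → ((L : ℤ) ^ j ∣ P))
    (hΛ : ∀ j, j ≤ k → ∀ (y : Site d) (i : Fin d), y + (P / (L : ℤ) ^ j) • e i ∈ Λs k j ↔ y ∈ Λs k j)
    -- the socket's antecedents: constants, (1.33), (1.34), (1.35) in print's p. 77 ONE-END-POINT class; `U₀`, `U′` periodic
    {α₀ α₁ B₀ cs α₄ cu : ℝ} (hα₀ : 0 < α₀) (hα₁ : 0 < α₁) (hB₀ : 0 < B₀)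
    (hcs : cs = 5 * (d : ℝ) * L * B₀ * (α₀ + α₁)) (hα₄ : 0 < α₄)
    {U₀ U' : Site d → Fin d → 𝔸ˣ} (hU₀ : ∀ x κ, U₀ x κ ∈ unitaryUnits 𝔸) (hU' : ∀ x κ, U' x κ ∈ unitaryUnits 𝔸)
    (hU₀per : ∀ x m : Site d, U₀ (x + P • m) = U₀ x) (hU'per : ∀ x m : Site d, U' (x + P • m) = U' x)
    (h33 : InAk L k η α₀ Ω U₀) (h34 : InAk L k η α₀ Ω (mulCfg U' U₀)) (hAx : ∀ m', m' ≤ k → InAx L m' (Λs m') U₀ (mulCfg U' U₀))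
    (h135 : ∀ j, j ≤ k → ∀ (z : Site d) (μ : Fin d),
        ((∀ x, InBox (tlo L z j) (thi L z j) x → x ∈ Ω j) ∨ (∀ x, InBox (tlo L (z + e μ) j) (thi L (z + e μ) j) x → x ∈ Ω j)) →
      ‖(avgIter L (mulCfg U' U₀) j z μ : 𝔸) - (avgIter L U₀ j z μ : 𝔸)‖ ≤ α₁)
    -- the datum of Theorem 4's uniqueness paragraph: `u₁` periodic with (1.29), an ABSTRACT gauge predicate `Lan k` for `U₁ = U′^{u₁⁻¹}`, the (1.62)-shape
    {u₁ : Site d → 𝔸ˣ} (hu₁ : ∀ x, u₁ x ∈ unitaryUnits 𝔸) (hu₁per : ∀ x m : Site d, u₁ (x + P • m) = u₁ x)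
    (h129 : Restr129 L k (Λs k) U₀ u₁)
    (Lan : ℕ → (Site d → Fin d → 𝔸ˣ) → Prop) (hLan : Lan k (mgauge U₀ u₁⁻¹ U'))
    (hdat : ∃ A₁ : Site d → Fin d → 𝔸, ∀ j, j ≤ k → ∀ (x : Site d) (κ : Fin d), SideTouches (Ω j) x κ →
      mgauge U₀ u₁⁻¹ U' x κ = cfgExp η A₁ x κ ∧ ‖A₁ x κ‖ ≤ cs * ((L : ℝ) ^ j * η)⁻¹)
    -- THE SOURCED b9 INPUT AT THE DATUM, TOP LEVEL `k` (the two (1.59)-lines with source terms `Sa`, `Sg` for every PERIODIC masked exponent of `U′^{u₁⁻¹}` —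
    -- what the knit's guarded `SH59src` delivers at `(k, u₁, U′^{u₁⁻¹})`)
    {Sa Sg : ℝ} (hSg : 0 ≤ Sg)
    (SH59k : ∀ A' : Site d → Fin d → 𝔸, (∀ x m : Site d, A' (x + P • m) = A' x) → (∀ y τ, IsSelfAdjoint (A' y τ)) →
      (∀ j, j ≤ k → ∀ (y : Site d) (τ : Fin d), SideTouches (Ω j) y τ →
        mgauge U₀ u₁⁻¹ U' y τ = cfgExp η A' y τ ∧ ‖A' y τ‖ ≤ cs * ((L : ℝ) ^ j * η)⁻¹) →
      (∀ (y : Site d) (τ : Fin d), (∀ j, j ≤ k → ¬ SideTouches (Ω j) y τ) → A' y τ = 0) →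
      msup L k η (-(1 : ℝ)) (fun j (b : Site d × Fin d) => SideTouches (Ω j) b.1 b.2) (fun b => A' b.1 b.2)
          ≤ B₀ * (bondNorm L k η (-(3 : ℝ)) Ω (fun x μ => Jcur η U₀ A' μ x)
          + wsup 1 (fun p : {p : ℕ × (Site d × Fin d) // p.1 ≤ k ∧ p.2 ∈ Λb k p.1} =>
          linCovIter L U₀ (iEta η A') p.1.1 p.1.2.1 p.1.2.2)) + Sa ∧
        msup L k η (-(2 : ℝ)) (fun j (t : Fin d × Fin d × Site d) => SideTouches (Ω j) t.2.2 t.2.1)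
          (fun t => covDerivFwd η U₀ t.1 (fun z => A' z t.2.1) t.2.2)
          ≤ B₀ * (bondNorm L k η (-(3 : ℝ)) Ω (fun x μ => Jcur η U₀ A' μ x)
          + wsup 1 (fun p : {p : ℕ × (Site d × Fin d) // p.1 ≤ k ∧ p.2 ∈ Λb k p.1} =>
          linCovIter L U₀ (iEta η A') p.1.1 p.1.2.1 p.1.2.2)) + Sg)
    -- Proposition 3's windows at `(α₀, α₂ := c⋆)` not implied by the JOIN's; EDITION γ: the (1.56) remainder constant `C₂ ≥ 8·131072(d+1)²·e^{4c·L²α₀}·L²`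
    {C₂ : ℝ} (hside : 36 * d * B₀ * cs ≤ 1 / 2)
    (hC₂ : 8 * (131072 * ((d : ℝ) + 1) ^ 2) * Real.exp (4 * (800 * ((d : ℝ) + 1) ^ 2 * ((d : ℝ) + 4)) * ((L : ℝ) ^ 2 * α₀))
      * (L : ℝ) ^ 2 ≤ C₂)
    (h61 : 2 * cs ^ 2 + 20 * d * α₀ * cs + 2 * C₂ * cs ^ 2 ≤ α₀ + α₁) (hsmall₁ : (d : ℝ) * L * α₁ ≤ 1 / 8)
    -- the [4] LETTERS at `(k, U₀)`, with the uniqueness laws AT PERIODIC ARGUMENTS and the periodicity-preservation laws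
    (g Δ : (Site d → 𝔸) →ₗ[ℂ] (Site d → 𝔸)) (q : (Site d → 𝔸) →ₗ[ℂ] (ℕ → Site d → 𝔸)) (qs : (ℕ → Site d → 𝔸) →ₗ[ℂ] (Site d → 𝔸))
    (Aw c : (ℕ → Site d → 𝔸) →ₗ[ℂ] (ℕ → Site d → 𝔸))
    (g_leftB : ∀ x : Site d → 𝔸, (∀ (z : Site d) (i : Fin d), x (z + P • e i) = x z) → (∃ C : ℝ, ∀ y, ‖x y‖ ≤ C) →
      g (Δ x + qs (Aw (q x))) = x)
    (c_left' : ∀ φ : ℕ → Site d → 𝔸, (∀ j, j ≤ k → ∀ (y : Site d) (i : Fin d), φ j (y + (P / (L : ℤ) ^ j) • e i) = φ j y) →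
      qs (c (q (g (g (qs φ))))) = qs φ)
    (hΔ : ∀ (f : Site d → 𝔸), ∀ x ∈ Ω 0, Δ f x = covLap η U₀ ((Ω 0).indicator f) x)
    (hqs : ∀ (μ : ℕ → Site d → 𝔸), ∀ x ∈ Ω 0, qs μ x = QT L k (Λs k) U₀ μ x)
    (hq : ∀ (f : Site d → 𝔸) (j : ℕ), j ≤ k → ∀ y ∈ Λs k j, q f j y = QprimeIter (zdBlocking d L) (bgT L U₀) j f y)
    (hq0 : ∀ (f : Site d → 𝔸) (j : ℕ) (y : Site d), ¬ (j ≤ k ∧ y ∈ Λs k j) → q f j y = 0)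
    (hGper : ∀ (f : Site d → 𝔸) (z : Site d) (i : Fin d), g f (z + P • e i) = g f z)
    (hAw_per : ∀ μ : ℕ → Site d → 𝔸, (∀ j, j ≤ k → ∀ (y : Site d) (i : Fin d), Aw μ j (y + (P / (L : ℤ) ^ j) • e i) = Aw μ j y))
    (H' : XSpace d k 𝔸 →ₗ[ℂ] (Site d → 𝔸)) {B₀'H B₂' BG BR : ℝ} (hB₀'H : 0 < B₀'H) (hB₂' : 0 ≤ B₂') (hBG : 0 ≤ BG) (hBR : 0 ≤ BR)
    (hH0 : ∀ (X : XSpace d k 𝔸) (x : Site d), ‖H' X x‖ ≤ B₀'H * ‖X‖)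
    (hH1 : ∀ j, j ≤ k → ∀ (X : XSpace d k 𝔸), ∀ p ∈ {b : Site d × Fin d | SideTouches (Ω j) b.1 b.2},
      wt L η j * ‖covDerivFwd η U₀ p.2 (H' X) p.1‖ ≤ B₀'H * ‖X‖)
    (hH2 : ∀ X : XSpace d k 𝔸, Bd2 L η k Ω (covLap η U₀ (H' X)) (B₂' * ‖X‖))
    (hHper : ∀ X : XSpace d k 𝔸, (∀ (p : Fin (k + 1) × Site d) (i : Fin d), X (p.1, p.2 + (P / (L : ℤ) ^ (p.1 : ℕ)) • e i) = X p) →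
      ∀ (z : Site d) (i : Fin d), H' X (z + P • e i) = H' X z)
    (hQH : ∀ (Y : XSpace d k 𝔸), (∀ (p : Fin (k + 1) × Site d) (i : Fin d), Y (p.1, p.2 + (P / (L : ℤ) ^ (p.1 : ℕ)) • e i) = Y p) →
      ∀ (j : ℕ) (hj : j ≤ k) (y : Site d), y ∈ Λs k j →
      QprimeIter (zdBlocking d L) (bgT L U₀) j (H' Y) y = Y (⟨j, Nat.lt_succ_of_le hj⟩, y))
    (hG : ∀ (f : Site d → 𝔸) (r : ℝ), 0 ≤ r → Bd2 L η k Ω f r →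
      (∀ x, ‖g f x‖ ≤ BG * r) ∧ ∀ j, j ≤ k → ∀ p ∈ {b : Site d × Fin d | SideTouches (Ω j) b.1 b.2},
        wt L η j * ‖covDerivFwd η U₀ p.2 (g f) p.1‖ ≤ BG * r)
    (hRbd : ∀ (f : Site d → 𝔸) (r : ℝ), 0 ≤ r → Bd2 L η k Ω f r → Bd2 L η k Ω (f - g (qs (c (q (g f))))) (BR * r))
    -- the JOIN's scalar windows, one-for-one (`αP := α₀`, `α₄` free; `cB cA cDA` free above their datum values; `c_{DA} ≥ dL²(c⋆ + 2Sg)`)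
    {cB cA cDA : ℝ} (hcBlo : L * cs ≤ cB) (hcAlo : L * cs ≤ cA) (hcDAlo : (d : ℝ) * (L : ℝ) ^ 2 * (cs + 2 * Sg) ≤ cDA)
    (hα3 : C0 d * α₀ ≤ 1 / 3) (hα4 : 4 * α₀ ≤ c2' d L)
    -- EDITION γ: [3] Prop. 4's windows of the (1.42)∕(1.56) steps ONE LEVEL LOWER, at `(L²α₀, c_B)` (`c_B ≥ L·c⋆`)
    (hα3L : C0 d * ((L : ℝ) ^ 2 * α₀) ≤ 1 / 3) (hα4L : 4 * ((L : ℝ) ^ 2 * α₀) ≤ c2' d L)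
    (hsmallL : Real.exp (4 * (800 * ((d : ℝ) + 1) ^ 2 * ((d : ℝ) + 4)) * ((L : ℝ) ^ 2 * α₀)) * (1 + 8 * (131072 * ((d : ℝ) + 1) ^ 2) * cB) ≤ 2)
    (hsmall : Real.exp (4 * (800 * ((d : ℝ) + 1) ^ 2 * ((d : ℝ) + 4)) * α₀) * (1 + 8 * (131072 * ((d : ℝ) + 1) ^ 2) * cB) ≤ 2)
    (hc₃ : 2 * cB ≤ c3 d L) (hsc : 2048 * (d : ℝ) * cB ≤ 1) (hα₃' : 40 * d * cB ≤ 1 / 200)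
    (hs₁ : 200 * C6 d * (2 * α₄) ≤ 1) (hs₂ : 12000 * ((d : ℝ) + 1) * L * (2 * α₄) ≤ 1)
    (hs₃ : C4G d L * (α₀ + 40 * d * cB + 4 * (2 * α₄)) ≤ 1)
    (hs₄ : 1024 * ((d : ℝ) + 1) * ((d : ℝ) + 4) * L ^ 2 * α₀ ≤ 1) (hs₅ : 32 * ((d : ℝ) + 1) ^ 2 * C6 d * L ^ 2 * α₀ ≤ 1)
    (hs₆ : 16 * d * C5' d * C6 d * (L : ℝ) ^ 2 * α₀ ≤ 1) (hs₇ : 8 * d * C6 d * L * α₀ ≤ 1)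
    (hsm : 40 * d * cB + α₄ ≤ 1 / (4 * B₀'H * (2 * C2p d))) (hprod8 : 2 * C6 d * (40 * d * cB + 4 * α₄) ≤ 1 / 8)
    {hE hE₂ lE lE₂ : ℝ} (hE_def : hE = B₀'H * (C2p d * (40 * d * cB + α₄) * α₄)) (hE₂_def : hE₂ = B₂' * (C2p d * (40 * d * cB + α₄) * α₄))
    (lE_def : lE = B₀'H * (4 * C2p d * (40 * d * cB + 2 * α₄))) (lE₂_def : lE₂ = B₂' * (4 * C2p d * (40 * d * cB + 2 * α₄)))
    (hcA' : cA ≤ 1 / 13) (ha₁' : α₄ / 4 + hE ≤ 1 / 24) (hb₁' : α₄ / 4 + hE ≤ 1 / 140) (hθ : 10 * (α₄ / 4 + hE) * BR ≤ 1 / 2)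
    (h103 : BG * Mc d BR (α₄ / 4 + hE) cA hE₂ cDA ≤ α₄ / 4)
    (h106 : BG * Kc d BR (α₄ / 4 + hE) cA hE₂ cDA lE₂ (1 + lE) (1 + lE) ≤ 1 / 2)
    -- the two uniqueness windows: Lipschitz modulus of `H_c`, and the radius `c_u` of (1.109) against the ¼α₄-ball
    (hlE : lE ≤ 1 / 2) (hcu : cu + hE ≤ α₄ / 4)
    -- the competitors, with PERIODIC exponents
    {v w : Site d → 𝔸ˣ} {lam mu : Site d → 𝔸}
    (hlP : ∀ x m : Site d, lam (x + P • m) = lam x) (hmP : ∀ x m : Site d, mu (x + P • m) = mu x)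
    (hv : ∀ x, ((gaugeExp lam x : 𝔸ˣ) : 𝔸) = ((v x : 𝔸ˣ) : 𝔸) ∧ IsSelfAdjoint (lam x) ∧ ‖lam x‖ < cu)
    (hvD : ∀ j, j ≤ k → ∀ b ∈ {b : Site d × Fin d | SideTouches (Ω j) b.1 b.2}, ((L : ℝ) ^ j * η) * ‖covDerivFwd η U₀ b.2 lam b.1‖ < cu)
    (hw : ∀ x, ((gaugeExp mu x : 𝔸ˣ) : 𝔸) = ((w x : 𝔸ˣ) : 𝔸) ∧ IsSelfAdjoint (mu x) ∧ ‖mu x‖ < cu)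
    (hwD : ∀ j, j ≤ k → ∀ b ∈ {b : Site d × Fin d | SideTouches (Ω j) b.1 b.2}, ((L : ℝ) ^ j * η) * ‖covDerivFwd η U₀ b.2 mu b.1‖ < cu)
    -- each competitor's gauge-fixed field obeys (1.38) at `k` levels (instance «zero source») and (1.29)
    (hLv : IsLandau138W L k η (Ω 0) (Λs k) U₀ (mgauge U₀ v⁻¹ (mgauge U₀ u₁⁻¹ U'))) (hRv : Restr129 L k (Λs k) U₀ (u₁ * v))
    (hLw : IsLandau138W L k η (Ω 0) (Λs k) U₀ (mgauge U₀ w⁻¹ (mgauge U₀ u₁⁻¹ U'))) (hRw : Restr129 L k (Λs k) U₀ (u₁ * w)) :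
    ∀ x, v x = w x := by
  subst hcs
  have hL1 : 1 ≤ L := le_trans (by norm_num) hL
  have hd1 : 1 ≤ d := le_trans (by norm_num) hd2
  have hLr : (1 : ℝ) ≤ L := by exact_mod_cast hL1
  have hd0 : (1 : ℝ) ≤ d := by exact_mod_cast hd1
  have huniv : ∀ x, x ∈ Ω 0 := fun x => by rw [hΩ0]; exact Set.mem_univ x
  obtain ⟨k', rfl⟩ : ∃ k', k = k' + 1 := ⟨k - 1, (Nat.sub_add_cancel hk).symm⟩
  have hsum : 0 < α₀ + α₁ := add_pos hα₀ hα₁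
  have hcs0 : 0 ≤ 5 * (d : ℝ) * L * B₀ * (α₀ + α₁) := by positivity
  have hcspos : 0 < 5 * (d : ℝ) * L * B₀ * (α₀ + α₁) := by positivity
  have hα₄pos : 0 < α₄ := hα₄
  -- the engines' one-direction currency `z + P • e i` of the full-lattice periodicity data
  have hU₀per' : ∀ (z : Site d) (i : Fin d), U₀ (z + P • e i) = U₀ z := fun z i => hU₀per z (e i)
  have hu₁per' : ∀ (z : Site d) (i : Fin d), u₁ (z + P • e i) = u₁ z := fun z i => hu₁per z (e i)
  have hlP' : ∀ (z : Site d) (i : Fin d), lam (z + P • e i) = lam z := fun z i => hlP z (e i)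
  have hmP' : ∀ (z : Site d) (i : Fin d), mu (z + P • e i) = mu z := fun z i => hmP z (e i)
  -- `c⋆ ≤ L·c⋆ ≤ cB`, hence Prop. 3's remaining windows from the JOIN's
  have hcsB : 5 * (d : ℝ) * L * B₀ * (α₀ + α₁) ≤ cB := (le_mul_of_one_le_left hcs0 hLr).trans hcBlo
  have hcB0 : 0 ≤ cB := hcs0.trans hcsB
  have hcA0 : 0 ≤ cA := (hcs0.trans (le_mul_of_one_le_left hcs0 hLr)).trans hcAlo
  have hcDA0 : 0 ≤ cDA := le_trans (by positivity) hcDAlo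
  have hcBsmall : (d : ℝ) * cB ≤ 1 / 8000 := by linarith only [hα₃']
  have hdcs : (d : ℝ) * (5 * (d : ℝ) * L * B₀ * (α₀ + α₁)) ≤ 1 / 8000 :=
    (mul_le_mul_of_nonneg_left hcsB (by positivity)).trans hcBsmall
  have hcs8000 : 5 * (d : ℝ) * L * B₀ * (α₀ + α₁) ≤ 1 / 8000 := (le_mul_of_one_le_left hcs0 hd0).trans hdcs
  have h16 : 16 * (5 * (d : ℝ) * L * B₀ * (α₀ + α₁)) ≤ 1 := by linarith only [hcs8000]
  have h50 : 50 * d * (5 * (d : ℝ) * L * B₀ * (α₀ + α₁)) ≤ 1 := by linarith only [hdcs]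
  have hd5 : 5 * (5 * (d : ℝ) * L * B₀ * (α₀ + α₁)) * ((d : ℝ) - 1) ≤ 4 := by nlinarith only [hdcs, hcs0]
  have hαP2 : 2 * α₀ ≤ c2' d L := by linarith only [hα4, hα₀]
  -- EDITION γ: the (1.42)∕(1.56) windows at `(L²α₀, L·c⋆)` from `L·c⋆ ≤ c_B`
  have hLcs : (L : ℝ) * (5 * (d : ℝ) * L * B₀ * (α₀ + α₁)) ≤ cB := hcBlo
  have hcB1 : cB ≤ (d : ℝ) * cB := le_mul_of_one_le_left hcB0 hd0
  have h16L : 16 * ((L : ℝ) * (5 * (d : ℝ) * L * B₀ * (α₀ + α₁))) ≤ 1 := by linarith only [hLcs, hcBsmall, hcB1]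
  have hc₃3L : 2 * ((L : ℝ) * (5 * (d : ℝ) * L * B₀ * (α₀ + α₁))) ≤ c3 d L := by linarith only [hc₃, hLcs]
  have hsmall3L : Real.exp (4 * (800 * ((d : ℝ) + 1) ^ 2 * ((d : ℝ) + 4)) * ((L : ℝ) ^ 2 * α₀)) *
      (1 + 8 * (131072 * ((d : ℝ) + 1) ^ 2) * ((L : ℝ) * (5 * (d : ℝ) * L * B₀ * (α₀ + α₁)))) ≤ 2 := by
    refine le_trans (mul_le_mul_of_nonneg_left ?_ (Real.exp_pos _).le) hsmallL
    have h := mul_le_mul_of_nonneg_left hLcs (show (0 : ℝ) ≤ 8 * (131072 * ((d : ℝ) + 1) ^ 2) by positivity)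
    linarith only [h]
  have hC2 : 0 ≤ C2p d := B8Ineq125Concrete.C2p_nonneg d
  have hhE : 0 ≤ hE := by rw [hE_def]; positivity
  -- the datum `U₁ = U′^{u₁⁻¹}`: unitary, PERIODIC on the full period lattice, `U₁^{u₁} = U′`, and its Hermitian logarithm on the touched bonds
  set U₁ : Site d → Fin d → 𝔸ˣ := mgauge U₀ u₁⁻¹ U' with hU₁def
  have hW : mgauge U₀ u₁ U₁ = U' := mgauge_mgauge_inv U₀ U' u₁
  have hWu : ∀ x κ, U₁ x κ ∈ unitaryUnits 𝔸 := mem_unitaryUnits_of_mgauge_eq hU₀ hU' hu₁ hW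
  have hU₁P : ∀ x m : Site d, U₁ (x + P • m) = U₁ x := fun x m => funext fun κ =>
    mgauge_periodic (p := P • m) (fun y κ => by rw [hU₀per y m]) (fun y κ => by rw [hU'per y m])
      (fun y => by rw [Pi.inv_apply, Pi.inv_apply, hu₁per y m]) x κ
  obtain ⟨A₁, hA₁⟩ := hdat
  have hdat' : ∀ j, j ≤ k' + 1 → ∀ b ∈ {b : Site d × Fin d | SideTouches (Ω j) b.1 b.2},
      U₁ b.1 b.2 = cfgExp η (logCfg η U₁) b.1 b.2 ∧ IsSelfAdjoint (logCfg η U₁ b.1 b.2) ∧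
        ‖logCfg η U₁ b.1 b.2‖ ≤ (5 * (d : ℝ) * L * B₀ * (α₀ + α₁)) * ((L : ℝ) ^ j * η)⁻¹ := by
    intro j hj b hb
    obtain ⟨hexp, hbd⟩ := hA₁ j hj b.1 b.2 hb
    have hbd' : ‖A₁ b.1 b.2‖ ≤ (5 * (d : ℝ) * L * B₀ * (α₀ + α₁)) * η⁻¹ := by
      refine hbd.trans ?_
      have hLj : (1 : ℝ) ≤ (L : ℝ) ^ j := one_le_pow₀ hLr
      have : ((L : ℝ) ^ j * η)⁻¹ ≤ η⁻¹ := by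
        rw [mul_inv]
        calc ((L : ℝ) ^ j)⁻¹ * η⁻¹ ≤ 1 * η⁻¹ := by gcongr; exact inv_le_one_of_one_le₀ hLj
          _ = η⁻¹ := one_mul _
      exact mul_le_mul_of_nonneg_left this hcs0
    obtain ⟨hlogA, hsa, hWexp⟩ := logField_spec hη U₀ hWu hexp hbd' (by linarith only [h16])
    refine ⟨hWexp, ?_, ?_⟩
    · simpa [logCfg] using hsa
    · show ‖logCfg η U₁ b.1 b.2‖ ≤ _
      rw [logCfg, hlogA]
      exact hbd
  -- the MASKED exponent `A′` (globally Hermitian); at `Ω 0 = univ` every bond is touched, so `U₁ = e^{iηA′}` GLOBALLY and `A′` is periodic on the full lattice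
  obtain ⟨A', hsa, hA'eq, hWA, hA0⟩ := exists_masked_datum hdat'
  have hWA1 : ∀ j, j ≤ k' → ∀ (y : Site d) (τ : Fin d), SideTouches (Ω j) y τ → U₁ y τ = cfgExp η A' y τ :=
    fun j hj y τ hs => (hWA j (Nat.le_succ_of_le hj) y τ hs).1
  have h41 : ∀ j, j ≤ k' → ∀ (y : Site d) (τ : Fin d), SideTouches (Ω j) y τ →
      ‖A' y τ‖ ≤ (5 * (d : ℝ) * L * B₀ * (α₀ + α₁)) * ((L : ℝ) ^ j * η)⁻¹ := fun j hj y τ hs => (hWA j (Nat.le_succ_of_le hj) y τ hs).2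
  have htouch0 : ∀ (y : Site d) (τ : Fin d), SideTouches (Ω 0) y τ := fun y τ => (sideTouches_pair_of_mem hd2 (huniv y) τ).1
  have hU₁eq : U₁ = cfgExp η A' := funext fun y => funext fun τ => (hWA 0 (Nat.zero_le _) y τ (htouch0 y τ)).1
  have hA'0 : ∀ (y : Site d) (τ : Fin d), ‖A' y τ‖ ≤ (5 * (d : ℝ) * L * B₀ * (α₀ + α₁)) * η⁻¹ := fun y τ => by
    have h := (hWA 0 (Nat.zero_le _) y τ (htouch0 y τ)).2
    rwa [pow_zero, one_mul] at h
  have hA'per : ∀ x m : Site d, A' (x + P • m) = A' x := fun x m => funext fun τ => by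
    rw [hA'eq 0 (Nat.zero_le _) _ τ (htouch0 _ τ), hA'eq 0 (Nat.zero_le _) x τ (htouch0 x τ), logCfg, logCfg, hU₁P x m]
  have hA'per' : ∀ (z : Site d) (i : Fin d), A' (z + P • e i) = A' z := fun z i => hA'per z (e i)
  -- the JOIN's datum binders BY NAME (`B8Prop5SocketDatum` §7, §3–§4)
  have h33' := h33_of_inAk hL1 hα₀ h33 le_rfl htower
  have hP' := hP_of_datum hL1 hα₀ hΩ h34 le_rfl htower hu₁ hW hWA1
  have h69' : ∀ j, j ≤ k' + 1 → ∀ y ∈ Λs (k' + 1) j, ∀ (x : Site d) (κ : Fin d), InBox (tlo L y j) (thi L y j) x →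
      InBox (tlo L y j) (thi L y j) (x + e κ) → ‖iEta η A' x κ‖ ≤ cB * ((L : ℝ) ^ j)⁻¹ :=
    fun j hj y hy x κ hx hxe =>
      (h69_of_datum hd2 hL1 hη hΩ htower hcs0 h41 j hj y hy x κ hx hxe).trans (mul_le_mul_of_nonneg_right hcBlo (by positivity))
  have hAd : ∀ j, j ≤ k' + 1 → ∀ x ∈ Ω j, ∀ μ : Fin d,
      wt L η j * ‖A' x μ‖ ≤ cA ∧ wt L η j * ‖conjR (U₀ (x - e μ) μ)⁻¹ (A' (x - e μ) μ)‖ ≤ cA := fun j hj x hx μ =>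
    ⟨(hA_of_datum hd2 hL1 hη hΩ hU₀ hcs0 h41 j hj x hx μ).1.trans hcAlo, (hA_of_datum hd2 hL1 hη hΩ hU₀ hcs0 h41 j hj x hx μ).2.trans hcAlo⟩
  have hBu : ∀ (x : Site d) (κ : Fin d), expCfg (iEta η A') x κ ∈ unitaryUnits 𝔸 := expCfg_iEta_mem_unitaryUnits η hsa
  have hexpA : expCfg (iEta η A') = U₁ := by rw [expCfg_iEta_eq_cfgExp, hU₁eq]
  have hAx' : InAx L (k' + 1) (Λs (k' + 1)) U₀ (mgauge U₀ u₁ (expCfg (iEta η A')) * U₀) := by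
    rw [hexpA, hW, ← mulCfg_eq_mul]
    exact hAx (k' + 1) le_rfl
  -- the source `D*A′`: (1.69)'s gradient member by Proposition 3 WITH SOURCE at the top level on the SOURCED b9 lines at the periodic `A′` (edition γ′),
  -- then `|D*A′|₍₋₂₎ ≤ d·L²·(c⋆ + 2Sg) ≤ cDA`
  obtain ⟨h59a, h59g⟩ := SH59k A' hA'per hsa hWA hA0
  have hgrad := grad_bound_of_datum_src_γ' hd2 hη hL (k' + 1) hU₀ hU' hα₀ hα₁ hcspos hB₀.le hα3L hα4L h16L hd5 hsmall3L hc₃3L hside h50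
    hC₂ h61 hsmall₁ Ω hΩ Λs Λb hbox hclass h33 h34 hAx h135 hk le_rfl htower Lan hu₁ hW h129 hLan hsa hWA hA0 h59a h59g
  have hcsS : 0 ≤ 5 * (d : ℝ) * L * B₀ * (α₀ + α₁) + 2 * Sg := by positivity
  have hDA : Bd2 L η (k' + 1) Ω (fun y => covDivB η U₀ A' y) cDA := fun j hj x hx =>
    (bd2_covDivB_of_grad hd2 hL1 hη hΩ hU₀ hcsS (fun j hj y κ τ hs => hgrad j (Nat.le_succ_of_le hj) y κ τ hs) j hj x hx).trans hcDAlo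
  -- the JOIN's bond classes `Eb j := {b ∣ SideTouches (Ω j) b}` (§6)
  have hEbΩ : ∀ j, j ≤ k' + 1 → ∀ x ∈ Ω j, ∀ μ : Fin d, (x, μ) ∈ {b : Site d × Fin d | SideTouches (Ω j) b.1 b.2} ∧
      (x - e μ, μ) ∈ {b : Site d × Fin d | SideTouches (Ω j) b.1 b.2} := fun j _ x hx μ => sideTouches_pair_of_mem hd2 hx μ
  have hEbT : ∀ j, j ≤ k' + 1 → ∀ y ∈ Λs (k' + 1) j, ∀ (x : Site d) (κ : Fin d), InBox (tlo L y j) (thi L y j) x →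
      InBox (tlo L y j) (thi L y j) (x + e κ) → (x, κ) ∈ {b : Site d × Fin d | SideTouches (Ω j) b.1 b.2} :=
    fun j hj y hy x κ hx _ => sideTouches_of_tower_bond hd2 htower hj hy x κ hx
  -- each competitor: `v = e^{iλ}` globally with `λ` periodic (given); its (1.38) of record is the multiplier clause of `HFP` at `A′` by the D*-identity,
  -- with a LEVEL-PERIODIC multiplier (the left side is periodic; `Q′ᵀ` is block-local and translation covariant)
  have hcu4 : cu ≤ α₄ / 4 := by linarith only [hcu, hhE]
  have hcu12 : cu ≤ 1 / 12 := by linarith only [hcu4, ha₁', hhE]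
  have hcu70 : cu ≤ 1 / 70 := by linarith only [hcu4, hb₁', hhE]
  have hcomp : ∀ (vv : Site d → 𝔸ˣ) (ll : Site d → 𝔸), (∀ (z : Site d) (i : Fin d), ll (z + P • e i) = ll z) →
      (∀ x, ((gaugeExp ll x : 𝔸ˣ) : 𝔸) = ((vv x : 𝔸ˣ) : 𝔸) ∧ IsSelfAdjoint (ll x) ∧ ‖ll x‖ < cu) →
      (∀ j, j ≤ k' + 1 → ∀ b ∈ {b : Site d × Fin d | SideTouches (Ω j) b.1 b.2}, ((L : ℝ) ^ j * η) * ‖covDerivFwd η U₀ b.2 ll b.1‖ < cu) →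
      IsLandau138W L (k' + 1) η (Ω 0) (Λs (k' + 1)) U₀ (mgauge U₀ vv⁻¹ (mgauge U₀ u₁⁻¹ U')) →
      vv = gaugeExp ll ∧ (∀ x, ‖ll x‖ ≤ cu) ∧
      (∀ j, j ≤ k' + 1 → ∀ p ∈ {b : Site d × Fin d | SideTouches (Ω j) b.1 b.2}, wt L η j * ‖covDerivFwd η U₀ p.2 ll p.1‖ ≤ cu) ∧
      (∃ μ : ℕ → Site d → 𝔸, (∀ j, j ≤ k' + 1 → ∀ (y : Site d) (i : Fin d), μ j (y + (P / (L : ℤ) ^ j) • e i) = μ j y) ∧ ∀ x ∈ Ω 0,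
        covLap η U₀ ((Ω 0).indicator fun y => covDivB η U₀ A' y + covLap η U₀ ll y +
          ((conjR (gaugeExp ll y)⁻¹ (covDivB η U₀ A' y) - covDivB η U₀ A' y) +
            (gAd (covLap η U₀ ll y) (ll y) - covLap η U₀ ll y) + ∑ μ, frakF3 η U₀ ll A' y μ)) x = QT L (k' + 1) (Λs (k' + 1)) U₀ μ x) := by
    intro vv ll hllP hll hllD hL138
    have hveq : vv = gaugeExp ll := funext fun x => (Units.ext (hll x).1).symm
    refine ⟨hveq, fun x => (hll x).2.2.le, fun j hj p hp => (hllD j hj p hp).le, ?_⟩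
    -- the Landau condition of record for `U₁^{v⁻¹} = (e^{iηA′})^{(e^{iλ})⁻¹}`, rewritten by the D*-identity on `Ω₀`
    have hL' : IsLandau138W L (k' + 1) η (Ω 0) (Λs (k' + 1)) U₀ (mgauge U₀ (gaugeExp ll)⁻¹ (cfgExp η A')) := by
      rw [← hveq, ← hU₁eq]; exact hL138
    obtain ⟨μ, hμ⟩ := hL'
    -- the left side is `P`-periodic: a level-periodic representative of the multiplier
    set W : Site d → Fin d → 𝔸ˣ := mgauge U₀ (gaugeExp ll)⁻¹ (cfgExp η A') with hWdef
    have hWP : ∀ (z : Site d) (i : Fin d), W (z + P • e i) = W z := fun z i => funext fun κ =>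
      mgauge_periodic (p := P • e i) (fun x κ => by rw [hU₀per' x i])
        (fun x κ => by show cfgExp η A' (x + P • e i) κ = cfgExp η A' x κ; unfold cfgExp; rw [hA'per' x i])
        (fun x => by rw [Pi.inv_apply, Pi.inv_apply, gaugeExp_per hllP x i]) z κ
    have hlogP : ∀ (z : Site d) (i : Fin d), logCfg η W (z + P • e i) = logCfg η W z := fun z i => funext fun κ => by
      show logCfg η W (z + P • e i) κ = logCfg η W z κ
      unfold logCfg; rw [hWP z i]
    have hFP : ∀ (z : Site d) (i : Fin d),
        covLap η U₀ ((Ω 0).indicator (covDivB η U₀ (logCfg η W))) (z + P • e i) = covLap η U₀ ((Ω 0).indicator (covDivB η U₀ (logCfg η W))) z := by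
      rw [hΩ0, Set.indicator_univ]
      exact covLap_per hU₀per' (covDivB_per hU₀per' hlogP)
    obtain ⟨μ', hμ'per, hμ'⟩ := exists_levelPeriodic_multiplier hL1 (k' + 1) hdiv hΛ hU₀per' hFP (fun x => hμ x (huniv x))
    refine ⟨μ', hμ'per, fun x hx => ?_⟩
    have hind : ((Ω 0).indicator fun y => covDivB η U₀ A' y + covLap η U₀ ll y +
        ((conjR (gaugeExp ll y)⁻¹ (covDivB η U₀ A' y) - covDivB η U₀ A' y) +
          (gAd (covLap η U₀ ll y) (ll y) - covLap η U₀ ll y) + ∑ μ, frakF3 η U₀ ll A' y μ)) =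
        (Ω 0).indicator (covDivB η U₀ (logCfg η (mgauge U₀ (gaugeExp ll)⁻¹ (cfgExp η A')))) := by
      refine Set.indicator_congr fun y _ => ?_
      have hly : ‖ll y‖ ≤ 1 / 12 := (hll y).2.2.le.trans hcu12
      have hDy : ∀ ν : Fin d, η * ‖covDerivFwd η U₀ ν ll y‖ ≤ 1 / 70 := fun ν => by
        have h := (hllD 0 (Nat.zero_le _) (y, ν) (htouch0 y ν)).le
        rw [pow_zero, one_mul] at h
        exact h.trans hcu70
      have hay : ∀ ν : Fin d, η * ‖covDeriv η U₀ ν ll y‖ ≤ 1 / 70 := fun ν => by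
        rw [norm_covDeriv_eq hU₀]
        have h := (hllD 0 (Nat.zero_le _) (y - e ν, ν) (htouch0 (y - e ν) ν)).le
        rw [pow_zero, one_mul] at h
        exact h.trans hcu70
      have hYy : ∀ ν : Fin d, η * ‖conjR (U₀ (y - e ν) ν)⁻¹ (A' (y - e ν) ν)‖ ≤ 1 / 12 := fun ν => by
        have hu : ((U₀ (y - e ν) ν)⁻¹ : 𝔸ˣ) ∈ U1 𝔸 := (U1 𝔸).inv_mem (unitaryUnits_le_U1 (hU₀ _ ν))
        rw [norm_conjR hu]
        calc η * ‖A' (y - e ν) ν‖ ≤ η * ((5 * (d : ℝ) * L * B₀ * (α₀ + α₁)) * η⁻¹) := mul_le_mul_of_nonneg_left (hA'0 _ ν) hη.le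
          _ = 5 * (d : ℝ) * L * B₀ * (α₀ + α₁) := by field_simp
          _ ≤ 1 / 12 := by linarith only [h16]
      exact (covDivB_logCfg_gaugeFixed hη U₀ A' hly hDy hay hYy).symm
    rw [hind]
    exact hμ' x
  obtain ⟨hveq, hl₁, hD₁, hmult₁⟩ := hcomp v lam hlP' hv hvD hLv
  obtain ⟨hweq, hl₂, hD₂, hmult₂⟩ := hcomp w mu hmP' hw hwD hLw
  have hR₁ : Restr129 L (k' + 1) (Λs (k' + 1)) U₀ (u₁ * gaugeExp lam) := by rw [← hveq]; exact hRv
  have hR₂ : Restr129 L (k' + 1) (Λs (k' + 1)) U₀ (u₁ * gaugeExp mu) := by rw [← hweq]; exact hRw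
  -- unitary Λ_j-witnesses for `u₁` (Theorem 4's inductive gauge transformation) at class constant `40d·c_B`, from (1.34), (1.29)
  have hα₃0 : (0 : ℝ) ≤ 40 * d * cB := by positivity
  have hwit : ∀ j, j ≤ k' + 1 → ∀ y ∈ Λs (k' + 1) j, ∃ ut : Site d → 𝔸ˣ, (∀ x, ut x ∈ unitaryUnits 𝔸) ∧
      InLambda L (clampCfg (tlo L y j) (thi L y j) U₀) ut j (40 * d * cB) (((L : ℝ) ^ j)⁻¹) ∧
      ∀ x : Site d, tlo L y j ≤ x → x ≤ thi L y j → u₁ x = ut x := fun j hj y hy =>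
    witness_unitary_of_glev hd1 hL hU₀ hα₀ hα3 hα4 (h33' j hj y hy) hcB0 hsmall hc₃ hsc hα₀ hα3 hαP2 hL1 hBu (h69' j hj y hy) (hP' j hj y hy)
      (glev_on_towers_of_axial hL1 (Λs (k' + 1)) hAx' h129 j hj y hy)
  -- THE UNIQUENESS JOIN ON THE TORUS, (U1)/(U2)/(1.91) AT PERIODIC ARGUMENTS (`hFP_unique_of_sectE_local_wb_per`, BY NAME) at `ρ := c_u`, `α₃ := 40d·c_B`
  have heq : lam = mu := hFP_unique_of_sectE_local_wb_per (Ω := Ω) (Λs := Λs (k' + 1))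
    (Eb := fun j => {b : Site d × Fin d | SideTouches (Ω j) b.1 b.2}) (u₁ := u₁) (A := A') hL hη hU₀ P hΩ0 hEbΩ hEbT g Δ q qs Aw c g_leftB
    c_left' hΔ hqs hq hq0 hdiv hΛ hU₀per' hA'per' hu₁per' hGper hAw_per H' hα₀ hα3 hα4 hα₃0 hα₄pos hB₀'H hB₂' h33' hwit h129 hH0 hH1 hH2 hHper
    hQH hα₃' hs₁ hs₂ hs₃ hs₄ hs₅ hs₆ hs₇ hsm hprod8 hE_def hE₂_def lE_def lE₂_def hBG hBR hcA0 hcA' hcDA0 ha₁' hb₁' hθ hlE hcu hG hRbd hDA hAd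
    h103 h106 hlP' hl₁ hD₁ hmult₁ hR₁ hmP' hl₂ hD₂ hmult₂ hR₂
  intro x
  rw [hveq, hweq, heq]

#print axioms sockP5uE_body_γ'_per

end Literature.MathematicalPhysics.QuantumFieldTheory.Balaban1983to89.B8SockP5uEBodyNestedPer

end
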